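import Summits.QuantumFields.YangMills.Theorems.BalabanUVNodesPortS1ChartDensityId
import Summits.QuantumFields.YangMills.Theorems.BalabanUVNodesPortS1FibreGraphWindow

/-!
# NODE O port PT-A — FE-1's chart law (T1), brick (B-d′) AT THE RECORD (`Lines/pta_residueW-STAR-FLAT-CHECK-v1.md` §6 (ii-b)): N11's PER-BOND DENSITY `jd_c` IN DEF-1's PAULI COORDINATES —
# at every configuration `U = pert Vk Y` on the fibre of `Ū(Vk)(c)` whose loops at `c` are STRICTLY α-small, for ANY blind sharp bundle `(ϑ, jd, jac′)` of the central α-window (forward law,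
# continuity, non-vanishing, left inverse, `jd = (jac′ ∘ ϑ)⁻¹`): `jd_c(U, Ū(Vk)(c)) = chartJac(B′(β c)) ∕ |det D_a q_c(B′(β c))|`, `q_c(a) := su2Coord(Q̃_c(Vk; Y[β c ↦ a]))`, `B′ = fluctVec Y` —
# [I] (2.10) p.267 «δ(Q̃(B′)) … the variables B′(b₀(c)) eliminated», the δ-function's Jacobian in the coordinates (2.4), NO `σ₀` (STAR-FLAT-CHECK-v1 (C4))

Cell `ym-nodeO-ideate`, porter seat PT-A-1 (gen 14); `--kind proof --supports stmt-QuantumFields-27930 --as helper`; count-neutral.  [I] = [Balaban1987RG1]; [16] = [Balaban1985UV3].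
Docket ★★★ director-ym №678 (2)(ii) ∕ №684 (2).  Over this seat's ✓`…PortS1ChartDensityId` (generic identification `inv_jac_eq_chartJac_div_abs_det`), ✓`…PortS1FibreGraphWindow`∕`…FibreGraphPoint`
(`norm_avg_pert_mul_inv_sub_one_le`), ✓`…PortS1ChartConstraint` (`recordQt_apply`, `recordQt_eq_zero_of_avg_eq`), ✓`…PortS1QtCReal`∕`…QtCQuad`∕`…RecordDtReal` (`recordQtC_ofReal_of_norm_lt`,
`differentiableOn_recordQtC_ball`, `recordQtC_ofReal_mem_lieSU`), ✓`…PortS1SmallLetter` (`sum_su2Coord_smul_su2Gen`), ✓`…ChartJacobianRecord` (`pert_apply_eq_chartAt`), lit `MatrixLog.exp_mlog`,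
lit `HolomorphicBanach.analyticOnNhd_of_differentiableOn` ([Chae1985] Thm 14.13),
`BlockAveragingEMLHaarAC.loopHol_update_centralBond_self`, `Node00.avOfRecord_measurable`.

WHAT IS PROVED (0 `def`, 0 `sorry`; `R := 1∕(10⁸·d·L)` the radius of the ✓QtC chain; `Vk` with loops `≤ α₀`, `157α₀ < L^{1−d}`).
§1 `su2CoordPauli_eq_sum_smul_su2Gen` (the two 𝔰𝔲(2) coordinate conventions agree), `coe_expPauli_toLp_su2Coord` (`↑(expPauli (su2Coord M)) = exp M` on `𝔰𝔲(2)`), `norm_fluctVec_apply_le`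
  (`‖B′(b)‖ ≤ √3·‖x‖`), `update_pert_centralBond_eq` (moving the central bond of `pert Vk Y` inside the chart = re-charting the `β c`-slot of `Y`).
§2 `contDiffOn_recordQt_ball` (DEF-1's REAL `Q̃(Vk; ·)` is `C¹` on the `R`-ball — restriction of the holomorphic ✓`recordQtC`), `avg_pert_eq_chartAt_su2Coord_recordQt` (THE CHART READ: inside the
  `R`-ball `Ū(pert Vk x)(c) = chartAt (Ū(Vk)(c)) (su2Coord (Q̃_c(Vk; x)))` — `exp ∘ mlog = id` on the `1∕50`-window).
§3 `isOpen_strictCentralWindow_chart` (the STRICT central α-window read in the Pauli chart at `β c` is open).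
§4 ★★★ `jd_eq_chartJac_div_abs_det_of_fibrePoint` — the displayed identity, for every blind sharp bundle (N11's clause shapes `hfwd`∕`hjacc`∕`hjac0`∕`hleft`∕`hQ` at `(c, U)`), with
  `det D_a q_c ≠ 0` as a by-product; ★★ `jac_mul_chartJac_eq_abs_det_of_fibrePoint` (the `jac′`-form `jac′_c(U, U(β c))·chartJac(B′(β c)) = |det D_a q_c|`).

HONEST FRAMING.  Chart calculus + the generic uniqueness lemma; the blind sharp bundle is a HYPOTHESIS here (supplied by ✓`…ChartOffCentral` in the assembly (iii)); the relation of
`det D_a q_c` to DEF-1's `det ∂_{b₀}Q̃ = det A₁ · det DΨ` (✓p829449) and the (B-★) assembly are NOT here; nothing of Bałaban's (2.10)–(2.14) estimates asserted, ported or discharged;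
`FEChartLawReg`∕`FEPolymerActivitiesReg`∕`P0HolExtAtRecordGL`∕`ClassP2Reg`∕`RegSelSmoothOnClass`∕`RegClassNestsUc` inhabited NOWHERE; ⟨27930⟩ OPEN 2∕7 · no claim; NODE O 0∕1; COUNT 8∕28 · K 1∕4 ·
legs 0∕6 UNMOVED; finite `𝕋⁴_{L^K}` at fixed ε — NOT continuum ∕ OS; **the Yang–Mills mass gap (Clay) is NOT proved by any of this.**  No `sorry`, no `def`, no `instance`; standard axioms only.
-/

noncomputable section

open MeasureTheory MeasureTheory.Measure Set Metric Function Filter Topology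
open scoped ENNReal NNReal BigOperators Matrix.Norms.L2Operator

namespace Summit.QuantumFields.YangMills.Theorems.BalabanUVNodesPortS1

open Literature.MathematicalPhysics.QuantumFieldTheory (haarProbability)
open Literature.MathematicalPhysics.QuantumFieldTheory.Balaban1983to89
open Literature.MathematicalPhysics.QuantumFieldTheory.Balaban1983to89.Node00
open Literature.MathematicalPhysics.QuantumFieldTheory.Balaban1983to89.T4Continuum (T4Family)
open Literature.MathematicalPhysics.QuantumFieldTheory.Balaban1983to89.T4AdjointCovarianceUnitary (lieSU)
open Literature.MathematicalPhysics.QuantumFieldTheory.Balaban1983to89.B10Eq22Rescaling (sigmaSU2 sigmaSU2_zero)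
open Literature.MathematicalPhysics.QuantumFieldTheory.Balaban1983to89.B10Eq18SigmaSU2Haar
open Literature.MathematicalPhysics.QuantumFieldTheory.Balaban1983to89.BlockAveraging (avgFun loopHol Small Idx)
open Literature.MathematicalPhysics.QuantumFieldTheory.Balaban1983to89.BlockAveragingHaarAC (centralBond pre post centralBond_injective)
open Literature.MathematicalPhysics.QuantumFieldTheory.Balaban1983to89.BlockAveragingEMLHaarAC (fibreFamily fibreFamily_of_isCentral dist1_fibreFamily_of_not_isCentral
  loopHol_update_centralBond_self)
open Literature.MathematicalPhysics.QuantumFieldTheory.Balaban1983to89.ExpMeanLog (expMeanLogSU)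
open Summit.QuantumFields.YangMills.Theorems.K0RecordFormatNames
open Summit.QuantumFields.YangMills.Theorems.BalabanUVNodesN11TransportOfRecordInPrivateCoordinateChart (succ_le_m_add_K)
open NormedSpace (exp)
open _root_.Matrix

variable (F : T4Family)

/-! ## §1  Coordinate bookkeeping -/

section Coord

/-- The two 𝔰𝔲(2) coordinate conventions of the tree agree: r07's `su2Coord v` (matrix of the vector `v`) IS `Σ_a v_a • su2Gen a` (DEF-1's basis `(iσ₁, iσ₂, iσ₃)`). [cite: Balaban1987RG1, (2.4) p.266 (bookkeeping)] -/
theorem su2CoordPauli_eq_sum_smul_su2Gen (v : Fin 3 → ℝ) : B10Eq18SigmaSU2.su2Coord v = ∑ a, ((v a : ℝ) : ℂ) • su2Gen a := by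
  ext i j
  simp only [B10Eq18SigmaSU2.su2Coord, su2Gen, Fin.sum_univ_three, Matrix.add_apply, Matrix.smul_apply, smul_eq_mul]
  fin_cases i <;> fin_cases j <;> (simp; try ring)

/-- `↑(expPauli (su2Coord M)) = exp M` for `M ∈ 𝔰𝔲(2)`: the Pauli chart vector of an 𝔰𝔲(2) matrix exponentiates to the matrix exponential (✓`sum_su2Coord_smul_su2Gen`).
[cite: Balaban1987RG1, (2.4) p.266 (bookkeeping)] [cite: Balaban1985UV3, p.260] -/
theorem coe_expPauli_toLp_su2Coord {M : MatA 2} (hM : M ∈ lieSU (Fin 2)) :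
    ((expPauli (WithLp.toLp 2 (su2Coord M)) : Matrix.specialUnitaryGroup (Fin 2) ℂ) : MatA 2) = exp M := by
  rw [coe_expPauli, WithLp.ofLp_toLp, su2CoordPauli_eq_sum_smul_su2Gen, sum_su2Coord_smul_su2Gen hM]

/-- `‖B′(b)‖ ≤ √3 · ‖x‖`: the Euclidean norm of one bond vector against the sup norm of all flat coordinates. [cite: Balaban1987RG1, (2.4) p.266 (bookkeeping)] -/
theorem norm_fluctVec_apply_le (k K : ℕ) (x : FluctIdx F k K → ℝ) (b : PBond (F.P K) k) : ‖fluctVec F k K x b‖ ≤ Real.sqrt 3 * ‖x‖ := by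
  rw [EuclideanSpace.norm_eq]
  have h : ∑ a : Fin 3, ‖fluctVec F k K x b a‖ ^ 2 ≤ 3 * ‖x‖ ^ 2 := by
    calc ∑ a : Fin 3, ‖fluctVec F k K x b a‖ ^ 2 ≤ ∑ _a : Fin 3, ‖x‖ ^ 2 := Finset.sum_le_sum fun a _ => by
            rw [fluctVec_apply]
            exact pow_le_pow_left₀ (norm_nonneg _) (norm_le_pi_norm x (b, a)) 2
      _ = 3 * ‖x‖ ^ 2 := by simp
  calc Real.sqrt (∑ a : Fin 3, ‖fluctVec F k K x b a‖ ^ 2) ≤ Real.sqrt (3 * ‖x‖ ^ 2) := Real.sqrt_le_sqrt h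
    _ = Real.sqrt 3 * ‖x‖ := by rw [Real.sqrt_mul (by norm_num), Real.sqrt_sq (norm_nonneg _)]

/-- ★ **MOVING THE CENTRAL BOND INSIDE THE CHART**: `(pert Vk Y)[β c ↦ chartAt (Vk (β c)) a] = pert Vk (Y[β c ↦ a])`, `Y[β c ↦ a] := fluctVec⁻¹ (update (fluctVec Y) (β c) a)` — re-charting the
`β c`-slot of the flat coordinates. [cite: Balaban1987RG1, (2.4) p.266, p.267 (bookkeeping)] -/
theorem update_pert_centralBond_eq (k K : ℕ) (Vk : GaugeField (F.P K) k (SU 2)) (Y : FluctIdx F k K → ℝ) (c : PBond (F.P K) (k + 1)) (a : EuclideanSpace ℝ (Fin 3)) :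
    update (pert F k K Vk Y) (centralBond c) (chartAt (Vk (centralBond c)) a) =
      pert F k K Vk ((fluctVec F k K).symm (update (fluctVec F k K Y) (centralBond c) a)) := by
  funext b
  rw [pert_apply_eq_chartAt, (fluctVec F k K).apply_symm_apply]
  by_cases hb : b = centralBond c
  · subst hb; rw [update_self, update_self]
  · rw [update_of_ne hb, update_of_ne hb, pert_apply_eq_chartAt]

/-- The re-charted coordinates at the own central vector are the original ones: `Y[β c ↦ B′(β c)] = Y`. [folklore] -/
theorem fluctVec_symm_update_self (k K : ℕ) (Y : FluctIdx F k K → ℝ) (c : PBond (F.P K) (k + 1)) :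
    (fluctVec F k K).symm (update (fluctVec F k K Y) (centralBond c) (fluctVec F k K Y (centralBond c))) = Y := by
  rw [update_eq_self, (fluctVec F k K).symm_apply_apply]

/-- The re-charting map `a ↦ Y[β c ↦ a]` is `C^∞` (each coordinate is a constant or a coordinate of `a`). [folklore] -/
theorem contDiff_fluctVec_symm_update (k K : ℕ) (Y : FluctIdx F k K → ℝ) (c : PBond (F.P K) (k + 1)) {n : WithTop ℕ∞} :
    ContDiff ℝ n fun a : EuclideanSpace ℝ (Fin 3) => (fluctVec F k K).symm (update (fluctVec F k K Y) (centralBond c) a) := by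
  refine contDiff_pi.2 fun i => ?_
  obtain ⟨b, j⟩ := i
  by_cases hb : b = centralBond c
  · subst hb
    have h : (fun a : EuclideanSpace ℝ (Fin 3) => (fluctVec F k K).symm (update (fluctVec F k K Y) (centralBond c) a) (centralBond c, j)) = fun a => a j := by
      funext a; rw [fluctVec_symm_apply, update_self]
    rw [h]
    exact (PiLp.proj 2 (𝕜 := ℝ) (fun _ : Fin 3 => ℝ) j).contDiff
  · have h : (fun a : EuclideanSpace ℝ (Fin 3) => (fluctVec F k K).symm (update (fluctVec F k K Y) (centralBond c) a) (b, j)) = fun _ => Y (b, j) := by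
      funext a; rw [fluctVec_symm_apply, update_of_ne hb, fluctVec_apply]
    rw [h]
    exact contDiff_const

/-- DEF-1's real coordinates `su2Coord : MatA 2 → ℝ³` (read in `EuclideanSpace`) are `C^∞` (ℝ-linear). [folklore] -/
theorem contDiff_toLp_su2Coord {n : WithTop ℕ∞} : ContDiff ℝ n fun M : MatA 2 => (WithLp.toLp 2 (su2Coord M) : EuclideanSpace ℝ (Fin 3)) := by
  refine (PiLp.contDiff_toLp).comp ?_
  refine contDiff_pi.2 fun j => ?_
  have hent : ∀ i i' : Fin 2, ContDiff ℝ n (fun M : MatA 2 => M i i') := fun i i' =>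
    (LinearMap.toContinuousLinearMap (⟨⟨fun M : MatA 2 => M i i', fun _ _ => rfl⟩, fun _ _ => rfl⟩ : MatA 2 →ₗ[ℝ] ℂ)).contDiff
  have him : ∀ i i' : Fin 2, ContDiff ℝ n (fun M : MatA 2 => (M i i').im) := fun i i' => Complex.imCLM.contDiff.comp (hent i i')
  have hre : ∀ i i' : Fin 2, ContDiff ℝ n (fun M : MatA 2 => (M i i').re) := fun i i' => Complex.reCLM.contDiff.comp (hent i i')
  fin_cases j
  · simpa [su2Coord] using him 0 1
  · simpa [su2Coord] using hre 0 1
  · simpa [su2Coord] using him 0 0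

end Coord

/-! ## §2  DEF-1's real `Q̃` is `C¹` on the `R`-ball; the chart read of the one-bond map -/

section ChartRead

variable {F}

/-- ★ **DEF-1's REAL `Q̃(Vk; ·)` IS `C¹` ON THE `R`-BALL** (`R = 1∕(10⁸dL)`): there it is the holomorphic ✓`recordQtC` read on the real slice (✓`recordQtC_ofReal_of_norm_lt`, ✓`differentiableOn_recordQtC_ball`).
[cite: Balaban1987RG1, p.267 («Q̃ … an analytic function of B′»)] -/
theorem contDiffOn_recordQt_ball {k K : ℕ} (hk : k + 1 ≤ (F.P K).m + (F.P K).K) (Vk : GaugeField (F.P K) k (SU 2)) {ε : ℝ}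
    (hε : ∀ (c : PBond (F.P K) (k + 1)) (i : Idx (F.P K)), ‖loopM (coeField Vk) c i - 1‖ ≤ ε) (hε50 : ε ≤ 1 / 50) (hVk : ∀ c, Small expMeanLogSU Vk c) :
    ContDiffOn ℝ 1 (recordQt F k K Vk) (ball (0 : FluctIdx F k K → ℝ) (1 / (10 ^ 8 * (F.P K).d * (F.P K).L))) := by
  set ι : (FluctIdx F k K → ℝ) →L[ℝ] (FluctIdx F k K → ℂ) := ContinuousLinearMap.pi fun i : FluctIdx F k K => Complex.ofRealCLM.comp (ContinuousLinearMap.proj i) with hιdef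
  have hι : ∀ x : FluctIdx F k K → ℝ, ι x = fun i => (x i : ℂ) := fun x => rfl
  have hC : ContDiffOn ℂ 1 (recordQtC F k K Vk) (ball (0 : FluctIdx F k K → ℂ) (1 / (10 ^ 8 * (F.P K).d * (F.P K).L))) :=
    (Literature.Analysis.Complex.HolomorphicBanach.analyticOnNhd_of_differentiableOn
      (differentiableOn_recordQtC_ball F k K hk Vk hε hε50 hVk) isOpen_ball).contDiffOn_of_completeSpace
  have hR : ContDiffOn ℝ 1 (recordQtC F k K Vk) (ball (0 : FluctIdx F k K → ℂ) (1 / (10 ^ 8 * (F.P K).d * (F.P K).L))) := hC.restrict_scalars ℝ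
  have hmaps : MapsTo ι (ball (0 : FluctIdx F k K → ℝ) (1 / (10 ^ 8 * (F.P K).d * (F.P K).L))) (ball (0 : FluctIdx F k K → ℂ) (1 / (10 ^ 8 * (F.P K).d * (F.P K).L))) := by
    intro x hx
    rw [mem_ball_zero_iff] at hx ⊢
    rw [hι]
    exact (norm_ofReal_pi_le x).trans_lt hx
  have hcomp : ContDiffOn ℝ 1 (fun x => recordQtC F k K Vk (ι x)) (ball (0 : FluctIdx F k K → ℝ) (1 / (10 ^ 8 * (F.P K).d * (F.P K).L))) :=
    hR.comp ι.contDiff.contDiffOn hmaps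
  refine hcomp.congr fun x hx => ?_
  rw [hι, recordQtC_ofReal_of_norm_lt F k K hk Vk hε hε50 hVk x (mem_ball_zero_iff.1 hx)]

/-- ★★ **THE CHART READ OF THE ONE-BOND MAP**: inside the `R`-ball, `Ū(pert Vk x)(c) = chartAt (Ū(Vk)(c)) (su2Coord (Q̃_c(Vk; x)))` — the coarse variable IS the Pauli chart point, centred at
`Ū(Vk)(c)`, of DEF-1's `Q̃_c` (`exp ∘ mlog = id` on the `1∕50`-window ✓`norm_avg_pert_mul_inv_sub_one_le`; `Q̃_c ∈ 𝔰𝔲(2)` ✓`recordQtC_ofReal_mem_lieSU`). [cite: Balaban1987RG1, (2.4) p.266, p.267] -/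
theorem avg_pert_eq_chartAt_su2Coord_recordQt {k K : ℕ} (hk : k + 1 ≤ (F.P K).m + (F.P K).K) (Vk : GaugeField (F.P K) k (SU 2)) {ε : ℝ}
    (hε : ∀ (c : PBond (F.P K) (k + 1)) (i : Idx (F.P K)), ‖loopM (coeField Vk) c i - 1‖ ≤ ε) (hε50 : ε ≤ 1 / 50) (hVk : ∀ c, Small expMeanLogSU Vk c)
    (x : FluctIdx F k K → ℝ) (hx : ‖x‖ < 1 / (10 ^ 8 * (F.P K).d * (F.P K).L)) (c : PBond (F.P K) (k + 1)) :
    (avOfRecord F 2 K k).avg (pert F k K Vk x) c = chartAt ((avOfRecord F 2 K k).avg Vk c) (WithLp.toLp 2 (su2Coord (recordQt F k K Vk x c))) := by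
  have hM : recordQt F k K Vk x c ∈ lieSU (Fin 2) := by
    rw [← recordQtC_ofReal_of_norm_lt F k K hk Vk hε hε50 hVk x hx]
    exact recordQtC_ofReal_mem_lieSU F k K hk Vk hε hε50 hVk x hx c
  have hW : ‖((((avOfRecord F 2 K k).avg (pert F k K Vk x) c * ((avOfRecord F 2 K k).avg Vk c)⁻¹ : SU 2) : MatA 2)) - 1‖ < 1 :=
    lt_of_le_of_lt (norm_avg_pert_mul_inv_sub_one_le F k K hk Vk hε hε50 hVk x hx c) (by norm_num)
  have hexp : ((expPauli (WithLp.toLp 2 (su2Coord (recordQt F k K Vk x c))) : Matrix.specialUnitaryGroup (Fin 2) ℂ) : MatA 2) =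
      ((((avOfRecord F 2 K k).avg (pert F k K Vk x) c * ((avOfRecord F 2 K k).avg Vk c)⁻¹ : SU 2) : MatA 2)) := by
    rw [coe_expPauli_toLp_su2Coord hM, recordQt_apply, MatrixLog.exp_mlog hW]
  have hexp' : expPauli (WithLp.toLp 2 (su2Coord (recordQt F k K Vk x c))) = (avOfRecord F 2 K k).avg (pert F k K Vk x) c * ((avOfRecord F 2 K k).avg Vk c)⁻¹ :=
    Subtype.ext hexp
  rw [chartAt_apply, hexp', inv_mul_cancel_right]

end ChartRead

/-! ## §3  The strict central window read in the Pauli chart is open -/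

section Window

variable {F}

/-- The STRICT central `α`-window at `c`, read in the Pauli chart at the bond `β c` (centre `u₀`), is open: `{a | ∀ i, dist1 (fibreFamily U c (pre·chartAt u₀ a·post) i) < α}`.
[cite: Balaban1987RG1, (0.4) p.253, (2.9) p.266 (bookkeeping)] -/
theorem isOpen_strictCentralWindow_chart {K k : ℕ} (U : GaugeField (F.P K) k (SU 2)) (c : PBond (F.P K) (k + 1)) (u₀ : SU 2) (α : ℝ) :
    IsOpen {a : EuclideanSpace ℝ (Fin 3) | ∀ i : Idx (F.P K), dist1 (fibreFamily U c (pre U c * chartAt u₀ a * post U c) i) < α} := by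
  have hset : {a : EuclideanSpace ℝ (Fin 3) | ∀ i : Idx (F.P K), dist1 (fibreFamily U c (pre U c * chartAt u₀ a * post U c) i) < α} =
      ⋂ i, {a | dist1 (fibreFamily U c (pre U c * chartAt u₀ a * post U c) i) < α} := by
    ext a; simp only [mem_setOf_eq, mem_iInter]
  rw [hset]
  refine isOpen_iInter_of_finite fun i => ?_
  have hW : Continuous fun a : EuclideanSpace ℝ (Fin 3) => pre U c * chartAt u₀ a * post U c := (continuous_const.mul (continuous_chartAt u₀)).mul continuous_const
  by_cases hi : BlockAveragingHaarAC.IsCentral c i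
  · have : {a : EuclideanSpace ℝ (Fin 3) | dist1 (fibreFamily U c (pre U c * chartAt u₀ a * post U c) i) < α} = {a | dist1 (1 : SU 2) < α} := by
      ext a; rw [mem_setOf_eq, mem_setOf_eq, fibreFamily_of_isCentral U c _ i hi]
    rw [this]
    exact isOpen_const
  · have : {a : EuclideanSpace ℝ (Fin 3) | dist1 (fibreFamily U c (pre U c * chartAt u₀ a * post U c) i) < α} =
        {a | ‖((BlockAveragingHaarAC.openHol U c i : SU 2) : MatA 2) * star (((pre U c * chartAt u₀ a * post U c : SU 2)) : MatA 2) - 1‖ < α} := by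
      ext a; rw [mem_setOf_eq, mem_setOf_eq, dist1_fibreFamily_of_not_isCentral U c _ i hi]
    rw [this]
    exact isOpen_lt ((continuous_const.mul (continuous_subtype_val.comp hW).star).sub continuous_const).norm continuous_const

end Window

/-! ## §4  N11's per-bond density at a fibre point, in DEF-1's coordinates -/

section Main

variable {F}

/-- ★★ **THE `jac′`-FORM AT A FIBRE POINT.**  `k < K`; `Vk` with loops `≤ α₀`, `157α₀ < L^{1−d}`; `Y` with `‖Y‖ < R`; `U := pert Vk Y` ON THE FIBRE at `c` (`Ū(U)(c) = Ū(Vk)(c)`) with loops at `c`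
STRICTLY `< α`; and ANY `(ϑ, jac′)` at `(c, U)` with N11's forward law `hfwd`, continuity `hjacc`, left inverse `hleft` on the central `α`-window (so in particular `jac′` measurable in `g`).  THEN, with
`q a := su2Coord (Q̃_c(Vk; Y[β c ↦ a]))` and `a⋆ := B′(β c) = fluctVec Y (β c)`:  `jac′(U(β c)) · chartJac a⋆ = |det D q(a⋆)|`. [cite: Balaban1987RG1, (2.10) p.267, p.268, (2.4) p.266] -/
theorem jac_mul_chartJac_eq_abs_det_of_fibrePoint {K k : ℕ} (hk : k < K) (Vk : GaugeField (F.P K) k (SU 2)) {α₀ : ℝ}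
    (hα₀ : ∀ (c : PBond (F.P K) (k + 1)) (i : Idx (F.P K)), dist1 (loopHol Vk c i) ≤ α₀) (hα₀L : 157 * α₀ < (((F.P K).L : ℝ) ^ ((F.P K).d - 1))⁻¹)
    (Y : FluctIdx F k K → ℝ) (hY : ‖Y‖ < 1 / (10 ^ 8 * (F.P K).d * (F.P K).L)) (c : PBond (F.P K) (k + 1))
    (hfib : (avOfRecord F 2 K k).avg (pert F k K Vk Y) c = (avOfRecord F 2 K k).avg Vk c) {α : ℝ}
    (hloops : ∀ i : Idx (F.P K), dist1 (loopHol (pert F k K Vk Y) c i) < α)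
    {ϑ : SU 2 → SU 2} {jac' : SU 2 → ℝ≥0} (hjacm : Measurable jac')
    (hfwd : (HaarData.haar : Measure (SU 2)).restrict
        ((fun g => (avOfRecord F 2 K k).avg (update (pert F k K Vk Y) (centralBond c) g) c) ''
          {g : SU 2 | ∀ i : Idx (F.P K), dist1 (fibreFamily (pert F k K Vk Y) c (pre (pert F k K Vk Y) c * g * post (pert F k K Vk Y) c) i) ≤ α}) =
      (((HaarData.haar : Measure (SU 2)).restrict
          {g : SU 2 | ∀ i : Idx (F.P K), dist1 (fibreFamily (pert F k K Vk Y) c (pre (pert F k K Vk Y) c * g * post (pert F k K Vk Y) c) i) ≤ α}).withDensity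
            fun g => (jac' g : ℝ≥0∞)).map (fun g => (avOfRecord F 2 K k).avg (update (pert F k K Vk Y) (centralBond c) g) c))
    (hjacc : ContinuousOn jac' {g : SU 2 | ∀ i : Idx (F.P K), dist1 (fibreFamily (pert F k K Vk Y) c (pre (pert F k K Vk Y) c * g * post (pert F k K Vk Y) c) i) ≤ α})
    (hleft : ∀ g : SU 2, (∀ i : Idx (F.P K), dist1 (fibreFamily (pert F k K Vk Y) c (pre (pert F k K Vk Y) c * g * post (pert F k K Vk Y) c) i) ≤ α) →
      ϑ ((avOfRecord F 2 K k).avg (update (pert F k K Vk Y) (centralBond c) g) c) = g) :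
    (jac' (pert F k K Vk Y (centralBond c)) : ℝ) * chartJac (fluctVec F k K Y (centralBond c)) =
      |(fderiv ℝ (fun a : EuclideanSpace ℝ (Fin 3) =>
          (WithLp.toLp 2 (su2Coord (recordQt F k K Vk ((fluctVec F k K).symm (update (fluctVec F k K Y) (centralBond c) a)) c)) : EuclideanSpace ℝ (Fin 3)))
        (fluctVec F k K Y (centralBond c))).det| := by
  -- numerics of the standing (o3) currency
  have hkr : k + 1 ≤ (F.P K).m + (F.P K).K := succ_le_m_add_K hk
  have hα50 : α₀ ≤ 1 / 50 := alpha_le_fiftieth_of_lt F K hα₀L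
  have hε := norm_loopM_sub_one_le_of_dist1 F Vk hα₀
  have hVk := small_of_dist1_le F Vk hα₀ hα50
  have hd : (1 : ℝ) ≤ (F.P K).d := by exact_mod_cast (F.P K).hd
  have hL : (1 : ℝ) ≤ (F.P K).L := by exact_mod_cast (F.P K).hL.2.le
  have hRpos : (0 : ℝ) < 1 / (10 ^ 8 * (F.P K).d * (F.P K).L) := by positivity
  have hRle : (1 : ℝ) / (10 ^ 8 * (F.P K).d * (F.P K).L) ≤ 1 / 10 ^ 8 :=
    one_div_le_one_div_of_le (by positivity) (by nlinarith)
  -- names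
  set U := pert F k K Vk Y with hU
  set u₀ : SU 2 := Vk (centralBond c) with hu₀
  set v₀ : SU 2 := (avOfRecord F 2 K k).avg Vk c with hv₀
  set Ω : Set (SU 2) := {g : SU 2 | ∀ i : Idx (F.P K), dist1 (fibreFamily U c (pre U c * g * post U c) i) ≤ α} with hΩ
  set Fm : SU 2 → SU 2 := fun g => (avOfRecord F 2 K k).avg (update U (centralBond c) g) c with hFm
  set ins : EuclideanSpace ℝ (Fin 3) → (FluctIdx F k K → ℝ) := fun a => (fluctVec F k K).symm (update (fluctVec F k K Y) (centralBond c) a) with hins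
  set q : EuclideanSpace ℝ (Fin 3) → EuclideanSpace ℝ (Fin 3) := fun a => WithLp.toLp 2 (su2Coord (recordQt F k K Vk (ins a) c)) with hq
  set as : EuclideanSpace ℝ (Fin 3) := fluctVec F k K Y (centralBond c) with has
  -- the domain of differentiability and the open chart window
  set N₀ : Set (EuclideanSpace ℝ (Fin 3)) := ins ⁻¹' ball (0 : FluctIdx F k K → ℝ) (1 / (10 ^ 8 * (F.P K).d * (F.P K).L)) with hN₀
  have hinsc : Continuous ins := (contDiff_fluctVec_symm_update F k K Y c (n := 1)).continuous
  have hN₀o : IsOpen N₀ := isOpen_ball.preimage hinsc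
  have hqN₀ : ContDiffOn ℝ 1 q N₀ := by
    have h1 : ContDiffOn ℝ 1 (fun a => recordQt F k K Vk (ins a)) N₀ :=
      (contDiffOn_recordQt_ball hkr Vk hε hα50 hVk).comp (contDiff_fluctVec_symm_update F k K Y c).contDiffOn (mapsTo_preimage _ _)
    have h2 : ContDiffOn ℝ 1 (fun a => recordQt F k K Vk (ins a) c) N₀ := by
      have := (contDiff_apply ℝ (MatA 2) c).comp_contDiffOn h1
      exact this
    exact contDiff_toLp_su2Coord.comp_contDiffOn h2
  have hqcN₀ : ContinuousOn q N₀ := hqN₀.continuousOn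
  set N : Set (EuclideanSpace ℝ (Fin 3)) := ball (0 : EuclideanSpace ℝ (Fin 3)) Real.pi ∩
    ({a | ∀ i : Idx (F.P K), dist1 (fibreFamily U c (pre U c * chartAt u₀ a * post U c) i) < α} ∩ (N₀ ∩ q ⁻¹' ball (0 : EuclideanSpace ℝ (Fin 3)) Real.pi)) with hN
  have hNo : IsOpen N := isOpen_ball.inter ((isOpen_strictCentralWindow_chart U c u₀ α).inter (hqcN₀.isOpen_inter_preimage hN₀o isOpen_ball))
  have hNπ : N ⊆ ball (0 : EuclideanSpace ℝ (Fin 3)) Real.pi := inter_subset_left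
  have hNN₀ : N ⊆ N₀ := fun a ha => ha.2.2.1
  have hNΩ : MapsTo (chartAt u₀) N Ω := fun a ha i => (ha.2.1 i).le
  have hqπ : MapsTo q N (ball (0 : EuclideanSpace ℝ (Fin 3)) Real.pi) := fun a ha => ha.2.2.2
  -- derivative on `N`
  have hq' : ∀ a ∈ N, HasFDerivAt q (fderiv ℝ q a) a := fun a ha =>
    ((hqN₀.differentiableOn one_ne_zero) a (hNN₀ ha)).differentiableAt (hN₀o.mem_nhds (hNN₀ ha)) |>.hasFDerivAt
  have hq'c : ContinuousOn (fderiv ℝ q) N := (hqN₀.continuousOn_fderiv_of_isOpen hN₀o le_rfl).mono hNN₀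
  -- the chart read on `N`
  have hFq : ∀ a ∈ N, Fm (chartAt u₀ a) = chartAt v₀ (q a) := by
    intro a ha
    have hxa : ‖ins a‖ < 1 / (10 ^ 8 * (F.P K).d * (F.P K).L) := mem_ball_zero_iff.1 (hNN₀ ha)
    show (avOfRecord F 2 K k).avg (update U (centralBond c) (chartAt u₀ a)) c = chartAt v₀ (q a)
    rw [hU, hu₀, update_pert_centralBond_eq, avg_pert_eq_chartAt_su2Coord_recordQt hkr Vk hε hα50 hVk _ hxa c]
  -- injectivity from the left inverse; measurability; continuity of `jac′` along the chart
  have hinj : InjOn Fm Ω := fun g hg g' hg' h => by rw [← hleft g hg, ← hleft g' hg']; exact congrArg ϑ h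
  have hFmeas : Measurable Fm :=
    (measurable_pi_apply c).comp ((avOfRecord_measurable F 2 K k).comp (measurable_update' (a := centralBond c) |>.comp (measurable_const.prodMk measurable_id)))
  have hΩm : MeasurableSet Ω := by
    have hW : Continuous fun g : SU 2 => pre U c * g * post U c := (continuous_const.mul continuous_id).mul continuous_const
    have hset : Ω = ⋂ i, {g : SU 2 | dist1 (fibreFamily U c (pre U c * g * post U c) i) ≤ α} := by ext g; simp only [hΩ, mem_setOf_eq, mem_iInter]
    rw [hset]
    refine MeasurableSet.iInter fun i => ?_
    by_cases hi : BlockAveragingHaarAC.IsCentral c i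
    · have : {g : SU 2 | dist1 (fibreFamily U c (pre U c * g * post U c) i) ≤ α} = {g | dist1 (1 : SU 2) ≤ α} := by
        ext g; rw [mem_setOf_eq, mem_setOf_eq, fibreFamily_of_isCentral U c _ i hi]
      rw [this]; exact MeasurableSet.const _
    · have : {g : SU 2 | dist1 (fibreFamily U c (pre U c * g * post U c) i) ≤ α} =
          {g | ‖((BlockAveragingHaarAC.openHol U c i : SU 2) : MatA 2) * star (((pre U c * g * post U c : SU 2)) : MatA 2) - 1‖ ≤ α} := by
        ext g; rw [mem_setOf_eq, mem_setOf_eq, dist1_fibreFamily_of_not_isCentral U c _ i hi]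
      rw [this]
      exact (isClosed_le ((continuous_const.mul (continuous_subtype_val.comp hW).star).sub continuous_const).norm continuous_const).measurableSet
  have hjc : ContinuousOn (fun a => (jac' (chartAt u₀ a) : ℝ)) N :=
    NNReal.continuous_coe.comp_continuousOn <| (hjacc.comp (continuous_chartAt u₀).continuousOn hNΩ)
  -- the solved point
  have hins_as : ins as = Y := fluctVec_symm_update_self F k K Y c
  have has_chart : chartAt u₀ as = U (centralBond c) := by rw [hU, pert_apply_eq_chartAt]
  have hq0 : q as = 0 := by
    show WithLp.toLp 2 (su2Coord (recordQt F k K Vk (ins as) c)) = 0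
    rw [hins_as, recordQt_eq_zero_of_avg_eq F k K Vk Y c hfib]
    have : su2Coord (0 : MatA 2) = 0 := by funext j; fin_cases j <;> simp [su2Coord]
    rw [this, WithLp.toLp_zero]
  have has_mem : as ∈ N := by
    refine ⟨?_, ?_, ?_, ?_⟩
    · rw [mem_ball_zero_iff]
      calc ‖as‖ ≤ Real.sqrt 3 * ‖Y‖ := norm_fluctVec_apply_le F k K Y (centralBond c)
        _ < Real.sqrt 3 * (1 / 10 ^ 8) := by
            have h3 : 0 < Real.sqrt 3 := Real.sqrt_pos.2 (by norm_num)
            exact mul_lt_mul_of_pos_left (hY.trans_le hRle) h3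
        _ ≤ 2 * (1 / 10 ^ 8) := by
            have : Real.sqrt 3 ≤ 2 := by
              rw [show (2 : ℝ) = Real.sqrt 4 by rw [show (4 : ℝ) = 2 ^ 2 by norm_num, Real.sqrt_sq (by norm_num)]]
              exact Real.sqrt_le_sqrt (by norm_num)
            exact mul_le_mul_of_nonneg_right this (by positivity)
        _ < Real.pi := by linarith [Real.pi_gt_three]
    · intro i
      rw [has_chart, ← loopHol_update_centralBond_self hkr U c (U (centralBond c)), update_eq_self]
      exact hloops i
    · show ins as ∈ ball (0 : FluctIdx F k K → ℝ) (1 / (10 ^ 8 * (F.P K).d * (F.P K).L))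
      rw [hins_as, mem_ball_zero_iff]; exact hY
    · show q as ∈ ball (0 : EuclideanSpace ℝ (Fin 3)) Real.pi
      rw [hq0, mem_ball_zero_iff, norm_zero]; exact Real.pi_pos
  -- the generic identification
  have h := jac_mul_chartJac_eq_abs_det_of_apply_eq_zero (Ω := Ω) (F := Fm) hFmeas hinj hjacm hfwd hNo hNπ hNΩ hq' hq'c hqπ hFq hjc has_mem hq0
  rwa [has_chart] at h

/-- ★★★ **N11's PER-BOND DENSITY `jd_c` AT A FIBRE POINT, IN DEF-1's PAULI COORDINATES.**  Under the hypotheses of ✓`jac_mul_chartJac_eq_abs_det_of_fibrePoint` plus N11's clauses `hjac0`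
(`jac′ ≠ 0` on the window) and `hQ` (`jd = (jac′ ∘ ϑ)⁻¹`):  `det D q(a⋆) ≠ 0` and **`jd(Ū(Vk)(c)) = chartJac(B′(β c)) ∕ |det D q(a⋆)|`** — the Jacobian of [I] (2.10)'s δ-function
`δ(Q̃_c(B′))` solved for `B′(β c)`, read in the coordinates (2.4); NO `σ₀` (STAR-FLAT-CHECK-v1 (C4), (F-a)∕(F-b)). [cite: Balaban1987RG1, (2.10) p.267, p.268, (2.4) p.266] [cite: Balaban1985UV3, (18) p.260] -/
theorem jd_eq_chartJac_div_abs_det_of_fibrePoint {K k : ℕ} (hk : k < K) (Vk : GaugeField (F.P K) k (SU 2)) {α₀ : ℝ}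
    (hα₀ : ∀ (c : PBond (F.P K) (k + 1)) (i : Idx (F.P K)), dist1 (loopHol Vk c i) ≤ α₀) (hα₀L : 157 * α₀ < (((F.P K).L : ℝ) ^ ((F.P K).d - 1))⁻¹)
    (Y : FluctIdx F k K → ℝ) (hY : ‖Y‖ < 1 / (10 ^ 8 * (F.P K).d * (F.P K).L)) (c : PBond (F.P K) (k + 1))
    (hfib : (avOfRecord F 2 K k).avg (pert F k K Vk Y) c = (avOfRecord F 2 K k).avg Vk c) {α : ℝ}
    (hloops : ∀ i : Idx (F.P K), dist1 (loopHol (pert F k K Vk Y) c i) < α)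
    {ϑ : SU 2 → SU 2} {jd jac' : SU 2 → ℝ≥0} (hjacm : Measurable jac')
    (hfwd : (HaarData.haar : Measure (SU 2)).restrict
        ((fun g => (avOfRecord F 2 K k).avg (update (pert F k K Vk Y) (centralBond c) g) c) ''
          {g : SU 2 | ∀ i : Idx (F.P K), dist1 (fibreFamily (pert F k K Vk Y) c (pre (pert F k K Vk Y) c * g * post (pert F k K Vk Y) c) i) ≤ α}) =
      (((HaarData.haar : Measure (SU 2)).restrict
          {g : SU 2 | ∀ i : Idx (F.P K), dist1 (fibreFamily (pert F k K Vk Y) c (pre (pert F k K Vk Y) c * g * post (pert F k K Vk Y) c) i) ≤ α}).withDensity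
            fun g => (jac' g : ℝ≥0∞)).map (fun g => (avOfRecord F 2 K k).avg (update (pert F k K Vk Y) (centralBond c) g) c))
    (hjacc : ContinuousOn jac' {g : SU 2 | ∀ i : Idx (F.P K), dist1 (fibreFamily (pert F k K Vk Y) c (pre (pert F k K Vk Y) c * g * post (pert F k K Vk Y) c) i) ≤ α})
    (hjac0 : ∀ g : SU 2, (∀ i : Idx (F.P K), dist1 (fibreFamily (pert F k K Vk Y) c (pre (pert F k K Vk Y) c * g * post (pert F k K Vk Y) c) i) ≤ α) → jac' g ≠ 0)
    (hleft : ∀ g : SU 2, (∀ i : Idx (F.P K), dist1 (fibreFamily (pert F k K Vk Y) c (pre (pert F k K Vk Y) c * g * post (pert F k K Vk Y) c) i) ≤ α) →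
      ϑ ((avOfRecord F 2 K k).avg (update (pert F k K Vk Y) (centralBond c) g) c) = g)
    (hQ : ∀ v : SU 2, jd v = (jac' (ϑ v))⁻¹) :
    (fderiv ℝ (fun a : EuclideanSpace ℝ (Fin 3) =>
          (WithLp.toLp 2 (su2Coord (recordQt F k K Vk ((fluctVec F k K).symm (update (fluctVec F k K Y) (centralBond c) a)) c)) : EuclideanSpace ℝ (Fin 3)))
        (fluctVec F k K Y (centralBond c))).det ≠ 0 ∧
    (jd ((avOfRecord F 2 K k).avg Vk c) : ℝ) = chartJac (fluctVec F k K Y (centralBond c)) /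
      |(fderiv ℝ (fun a : EuclideanSpace ℝ (Fin 3) =>
          (WithLp.toLp 2 (su2Coord (recordQt F k K Vk ((fluctVec F k K).symm (update (fluctVec F k K Y) (centralBond c) a)) c)) : EuclideanSpace ℝ (Fin 3)))
        (fluctVec F k K Y (centralBond c))).det| := by
  have hkr : k + 1 ≤ (F.P K).m + (F.P K).K := succ_le_m_add_K hk
  have h := jac_mul_chartJac_eq_abs_det_of_fibrePoint hk Vk hα₀ hα₀L Y hY c hfib hloops hjacm hfwd hjacc hleft
  -- the own central value is in the window, and `ϑ` returns it at the own average
  have hwin : ∀ i : Idx (F.P K), dist1 (fibreFamily (pert F k K Vk Y) c (pre (pert F k K Vk Y) c * pert F k K Vk Y (centralBond c) * post (pert F k K Vk Y) c) i) ≤ α := by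
    intro i
    rw [← loopHol_update_centralBond_self hkr (pert F k K Vk Y) c (pert F k K Vk Y (centralBond c)), update_eq_self]
    exact (hloops i).le
  have hθ : ϑ ((avOfRecord F 2 K k).avg Vk c) = pert F k K Vk Y (centralBond c) := by
    rw [← hfib]
    exact theta_apply_avg_eq_centralBond_of_leftInverse (ϑ := fun _ _ => ϑ) c (pert F k K Vk Y) hleft hwin
  have hj0 : jac' (pert F k K Vk Y (centralBond c)) ≠ 0 := hjac0 _ hwin
  have hjpos : 0 < (jac' (pert F k K Vk Y (centralBond c)) : ℝ) := lt_of_le_of_ne (NNReal.coe_nonneg _) (fun h0 => hj0 (NNReal.coe_eq_zero.1 h0.symm))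
  have hcj : 0 < chartJac (fluctVec F k K Y (centralBond c)) := by
    have hd : (1 : ℝ) ≤ (F.P K).d := by exact_mod_cast (F.P K).hd
    have hL : (1 : ℝ) ≤ (F.P K).L := by exact_mod_cast (F.P K).hL.2.le
    have hRle : (1 : ℝ) / (10 ^ 8 * (F.P K).d * (F.P K).L) ≤ 1 / 10 ^ 8 :=
      one_div_le_one_div_of_le (by positivity) (by nlinarith)
    have hπ : ‖fluctVec F k K Y (centralBond c)‖ < Real.pi := by
      calc ‖fluctVec F k K Y (centralBond c)‖ ≤ Real.sqrt 3 * ‖Y‖ := norm_fluctVec_apply_le F k K Y (centralBond c)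
        _ ≤ 2 * ‖Y‖ := by
            refine mul_le_mul_of_nonneg_right ?_ (norm_nonneg _)
            rw [show (2 : ℝ) = Real.sqrt 4 by rw [show (4 : ℝ) = 2 ^ 2 by norm_num, Real.sqrt_sq (by norm_num)]]
            exact Real.sqrt_le_sqrt (by norm_num)
        _ < Real.pi := by nlinarith [hY.trans_le hRle, Real.pi_gt_three, norm_nonneg Y]
    rw [chartJac]
    exact div_pos (B10Eq22Rescaling.sigmaSU2_pos (norm_nonneg _) hπ) (by rw [sigmaSU2_zero]; positivity)
  have hdet : 0 < |(fderiv ℝ (fun a : EuclideanSpace ℝ (Fin 3) =>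
          (WithLp.toLp 2 (su2Coord (recordQt F k K Vk ((fluctVec F k K).symm (update (fluctVec F k K Y) (centralBond c) a)) c)) : EuclideanSpace ℝ (Fin 3)))
        (fluctVec F k K Y (centralBond c))).det| := by rw [← h]; exact mul_pos hjpos hcj
  refine ⟨abs_pos.1 hdet, ?_⟩
  rw [hQ, hθ, NNReal.coe_inv, eq_div_iff hdet.ne', ← h, ← mul_assoc, inv_mul_cancel₀ hjpos.ne', one_mul]

end Main

end Summit.QuantumFields.YangMills.Theorems.BalabanUVNodesPortS1

end
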